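import Literature.LinearAlgebra.Matrix.UnitaryThreeMinimalNilpotentWitt      -- ★ (E) (F0P3-p02 g22): `unitary_conj_mem`, `inv_eq_of_unitary`, `isUnit_det_of_unitary`, `antidiagonal_three_mul_self`
import Literature.MeasureTheory.Group.LocFiniteLIntegralProductTransfer        -- ★ (G-FUB) p852081 (F0P3a-p07 g19): `exists_nhds_setLIntegral_lt_top_iff_of_addEquiv`
import Literature.NumberTheory.GaloisRepresentations.LocalField                -- ★ `IsNonarchimedeanLocalField.normAbs` (the R2 integrand token `ηι`)
import Mathlib.LinearAlgebra.Matrix.Charpoly.Disc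
import Mathlib.Topology.Algebra.ContinuousMonoidHom
import Mathlib.Topology.Instances.Matrix
import HarnessLib

/-!
# F0 · P3c · line LH6 «StCharTS» — ROAD «HC-D» brick (AD) «Ad-TRANSPORT ON `↥𝔲₀`»: conjugation by a unitary `g` is a `≃ₜ+` of `𝔲₀` (and of `𝔲`), it fixes
# `χ`, `discr χ` and the integrand `ηι`, and local `∫⁻`-finiteness of `ηι` near `X₀` transfers to `Ad(g) X₀`

Cell `pub/hodgecm-mathlib`, crux H413 = `stmt-HodgeConjecture-24833` (lane `--supports … --as helper`), route HCCMUnconditional; seat F0P2-p06 (g18), brick (AD) of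
the road «HC-D» of F0P2-p01 (g23) (deal: bus F0∕P2 2026-09-02T16:47:16Z).  THEOREMS ONLY (no definition ∕ instance ∕ notation ∕ named fact ∕ `sorry`); Mathlib + ★ (E)
`Literature/LinearAlgebra/Matrix/UnitaryThreeMinimalNilpotentWitt` + ★ (G-FUB) `Literature/MeasureTheory/Group/LocFiniteLIntegralProductTransfer` + ★ `…GaloisRepresentations.LocalField`.

SETTING (R3 letters).  `K` a field with an involution `σ` (`hσ`), the form `J = Φ₃ = !![0,0,1;0,1,0;1,0,0]` (`hJ`), ARBITRARY additive subgroups `𝔲`, `𝔲₀ ≤ M₃(K)` with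
`h𝔲 : X ∈ 𝔲 ↔ (X.map σ)ᵀ * J + J * X = 0`, `h𝔲₀ : X ∈ 𝔲₀ ↔ (…) ∧ trace X = 0`, and a UNITARY `g` (`hg : (g.map σ)ᵀ * J * g = J`).

* §1 algebra: `unitary_inv` (`g⁻¹` is unitary), `trace_conj_eq` (`tr(gXg⁻¹) = tr X`), `charpoly_conj_eq` (`χ_{gXg⁻¹} = χ_X`, Mathlib `charpoly_units_conj`), `discr_charpoly_conj_eq`.
* §2 **`exists_adEquiv_traceZero`** ∕ `exists_adEquiv_lie` — `∃ Adg : ↥𝔲₀ ≃ₜ+ ↥𝔲₀, ∀ X, (Adg X : M₃(K)) = g * X * g⁻¹` (inverse `X ↦ g⁻¹ X g`; ★ (E) `unitary_conj_mem` both ways),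
  and the `↥𝔲` twin.
* §3 **`etaIota_conj_eq`** — the R2 integrand `ηι X := (↑√√(normAbs K (discr χ_X)))⁻¹ : ℝ≥0∞` is `Ad(g)`-invariant (it factors through `χ`);
  **`exists_nhds_setLIntegral_lt_top_iff_ad`** — for ANY additive Haar measure `μ₀` on `↥𝔲₀` (locally compact, second countable — supplied by (CO)'s chart in the model)
  and any `Ad(g)`-invariant `f : ↥𝔲₀ → ℝ≥0∞`: `(∃ U ∈ 𝓝 X₀, ∫⁻_U f ∂μ₀ < ∞) ↔ (∃ U ∈ 𝓝 (Adg X₀), ∫⁻_U f ∂μ₀ < ∞)` (★ (G-FUB) one-factor transfer with `W = V = ↥𝔲₀`; the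
  Haar constant is absorbed there), and its `ηι` instance `exists_nhds_setLIntegral_etaIota_lt_top_iff_ad`.
Consumers: D5(iii) WITT MOVE (A-p12 (g29): every rank-one square-zero `N′ ∈ 𝔲₀` is `Ad(g)`-conjugate to the model `c·E₀₂`, ★ (E) `exists_unitary_conj_single_zero_two`) and
GLOBAL-FINAL (F0P3a-p07 (g19)).
HONEST LABEL: HC_CM is proved only modulo the 7 printed citations (2 remaining named inputs: hLiu418 = `stmt-HodgeConjecture-24832`, h413 = `stmt-HodgeConjecture-24833`)
until rung 0 closes; this file closes no organ (count-neutral plumbing for the (HC-D) named input `hDGliO` of ★ RUNG0).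

## References
* [Rogawski1990] J. D. Rogawski, *Automorphic Representations of Unitary Groups in Three Variables*, Ann. of Math. Stud. 123 (1990), §1.9 p. 8 (the unitary group and its
  adjoint action), §4.9 p. 54 (`D_G` is a class function).
* [Folland1999] G. B. Folland, *Real Analysis*, 2nd ed. (1999), §11.1 Thm. 11.9 (uniqueness of Haar measure; transport along a topological isomorphism).
* [HarishChandra1970] Harish-Chandra, *Harmonic analysis on reductive p-adic groups*, LNM 162 (1970), Part VII §1 Thm. 15.
-/

set_option autoImplicit false
-- the mandated namespace has the single-problem summit's repeated segment (`HodgeConjecture.HodgeConjecture`)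
set_option linter.dupNamespace false

open Matrix Topology MeasureTheory Filter
open Literature.LinearAlgebra.Matrix.UnitaryThreeWitt
open scoped ENNReal

namespace Summit.HodgeConjecture.HodgeConjecture.Cruxes.H413.F0P3cStCharTSHCDAdTransport

/-! ## §1 Algebra of `Ad(g)` for a unitary `g` -/

section Algebra

variable {K : Type*} [Field K] (σ : K →+* K) (hσ : ∀ x, σ (σ x) = x)

/-- `g · J · (g.map σ)ᵀ = J` for a unitary `g` (the «right» unitarity, from `g g⁻¹ = 1` and ★ `inv_eq_of_unitary`). [cite: Rogawski1990, §1.9 p. 8] -/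
theorem mul_antidiagonal_mul_map_transpose {g : Matrix (Fin 3) (Fin 3) K}
    (hg : (g.map σ)ᵀ * !![(0 : K), 0, 1; 0, 1, 0; 1, 0, 0] * g = !![(0 : K), 0, 1; 0, 1, 0; 1, 0, 0]) :
    g * !![(0 : K), 0, 1; 0, 1, 0; 1, 0, 0] * (g.map σ)ᵀ = !![(0 : K), 0, 1; 0, 1, 0; 1, 0, 0] := by
  have hdet := isUnit_det_of_unitary σ hg
  have h1 : g * g⁻¹ = 1 := Matrix.mul_nonsing_inv g hdet
  rw [inv_eq_of_unitary σ hg] at h1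
  have h2 := congrArg (· * !![(0 : K), 0, 1; 0, 1, 0; 1, 0, 0]) h1
  simp only [Matrix.mul_assoc, antidiagonal_three_mul_self, Matrix.mul_one, Matrix.one_mul] at h2
  simpa only [Matrix.mul_assoc] using h2

include hσ in
/-- **The inverse of a unitary matrix is unitary**: `((g⁻¹).map σ)ᵀ J g⁻¹ = J`. [cite: Rogawski1990, §1.9 p. 8] -/
theorem unitary_inv {g : Matrix (Fin 3) (Fin 3) K}
    (hg : (g.map σ)ᵀ * !![(0 : K), 0, 1; 0, 1, 0; 1, 0, 0] * g = !![(0 : K), 0, 1; 0, 1, 0; 1, 0, 0]) :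
    ((g⁻¹).map σ)ᵀ * !![(0 : K), 0, 1; 0, 1, 0; 1, 0, 0] * g⁻¹ = !![(0 : K), 0, 1; 0, 1, 0; 1, 0, 0] := by
  have hJσ : (!![(0 : K), 0, 1; 0, 1, 0; 1, 0, 0]).map σ = !![(0 : K), 0, 1; 0, 1, 0; 1, 0, 0] := by
    ext i j; fin_cases i <;> fin_cases j <;> simp
  have hJt : (!![(0 : K), 0, 1; 0, 1, 0; 1, 0, 0])ᵀ = !![(0 : K), 0, 1; 0, 1, 0; 1, 0, 0] := by
    ext i j; fin_cases i <;> fin_cases j <;> simp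
  have hgσσ : (g.map σ).map σ = g := by ext i j; simp [hσ]
  -- `(g⁻¹).map σ = J gᵀ J`, so `((g⁻¹).map σ)ᵀ = J g J`
  have hinvσt : ((g⁻¹).map σ)ᵀ = !![(0 : K), 0, 1; 0, 1, 0; 1, 0, 0] * g * !![(0 : K), 0, 1; 0, 1, 0; 1, 0, 0] := by
    rw [inv_eq_of_unitary σ hg, Matrix.map_mul, Matrix.map_mul, hJσ, Matrix.transpose_map, hgσσ, Matrix.transpose_mul, Matrix.transpose_mul, hJt,
      Matrix.transpose_transpose, Matrix.mul_assoc]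
  rw [hinvσt, inv_eq_of_unitary σ hg]
  have key := mul_antidiagonal_mul_map_transpose σ hg
  calc !![(0 : K), 0, 1; 0, 1, 0; 1, 0, 0] * g * !![(0 : K), 0, 1; 0, 1, 0; 1, 0, 0] * !![(0 : K), 0, 1; 0, 1, 0; 1, 0, 0] *
        (!![(0 : K), 0, 1; 0, 1, 0; 1, 0, 0] * (g.map σ)ᵀ * !![(0 : K), 0, 1; 0, 1, 0; 1, 0, 0])
      = !![(0 : K), 0, 1; 0, 1, 0; 1, 0, 0] * (g * (!![(0 : K), 0, 1; 0, 1, 0; 1, 0, 0] * !![(0 : K), 0, 1; 0, 1, 0; 1, 0, 0]) *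
          (!![(0 : K), 0, 1; 0, 1, 0; 1, 0, 0] * (g.map σ)ᵀ)) * !![(0 : K), 0, 1; 0, 1, 0; 1, 0, 0] := by
        simp only [Matrix.mul_assoc]
    _ = !![(0 : K), 0, 1; 0, 1, 0; 1, 0, 0] * (g * !![(0 : K), 0, 1; 0, 1, 0; 1, 0, 0] * (g.map σ)ᵀ) * !![(0 : K), 0, 1; 0, 1, 0; 1, 0, 0] := by
        rw [antidiagonal_three_mul_self, Matrix.mul_one, Matrix.mul_assoc g]
    _ = !![(0 : K), 0, 1; 0, 1, 0; 1, 0, 0] := by rw [key, antidiagonal_three_mul_self, Matrix.one_mul]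

/-- `tr(g X g⁻¹) = tr X` for `det g` a unit. [cite: Rogawski1990, §4.9 p. 54] -/
theorem trace_conj_eq {g : Matrix (Fin 3) (Fin 3) K} (hdet : IsUnit g.det) (X : Matrix (Fin 3) (Fin 3) K) :
    Matrix.trace (g * X * g⁻¹) = Matrix.trace X := by
  rw [Matrix.trace_mul_cycle, Matrix.nonsing_inv_mul g hdet, Matrix.one_mul]

/-- **`χ_{g X g⁻¹} = χ_X`** for `det g` a unit (Mathlib `charpoly_units_conj` on the unit `g.nonsingInvUnit`). [cite: Rogawski1990, §4.9 p. 54] -/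
theorem charpoly_conj_eq {g : Matrix (Fin 3) (Fin 3) K} (hdet : IsUnit g.det) (X : Matrix (Fin 3) (Fin 3) K) :
    (g * X * g⁻¹).charpoly = X.charpoly :=
  Matrix.charpoly_units_conj (g.nonsingInvUnit hdet) X

/-- `discr χ_{g X g⁻¹} = discr χ_X` for `det g` a unit. [cite: Rogawski1990, §4.9 p. 54] -/
theorem discr_charpoly_conj_eq {g : Matrix (Fin 3) (Fin 3) K} (hdet : IsUnit g.det) (X : Matrix (Fin 3) (Fin 3) K) :
    (g * X * g⁻¹).charpoly.discr = X.charpoly.discr := by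
  rw [charpoly_conj_eq hdet]

end Algebra

/-! ## §2 `Ad(g)` as a continuous additive automorphism of `𝔲₀` and of `𝔲` -/

section Ad

variable {K : Type*} [Field K] [TopologicalSpace K] [IsTopologicalRing K]
  (σ : K →+* K) (hσ : ∀ x, σ (σ x) = x)
  {J : Matrix (Fin 3) (Fin 3) K} (hJ : J = !![0, 0, 1; 0, 1, 0; 1, 0, 0])

include hσ hJ

/-- **`Ad(g) : ↥𝔲₀ ≃ₜ+ ↥𝔲₀`** for a unitary `g`: `X ↦ g X g⁻¹`, inverse `X ↦ g⁻¹ X g` (both in `𝔲₀` by ★ (E) `unitary_conj_mem` for `g` and for the unitary `g⁻¹`, traces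
preserved), additive and continuous both ways. [cite: Rogawski1990, §1.9 p. 8] -/
theorem exists_adEquiv_traceZero (𝔲₀ : AddSubgroup (Matrix (Fin 3) (Fin 3) K))
    (h𝔲₀ : ∀ X, X ∈ 𝔲₀ ↔ (X.map σ)ᵀ * J + J * X = 0 ∧ Matrix.trace X = 0)
    {g : Matrix (Fin 3) (Fin 3) K} (hg : (g.map σ)ᵀ * J * g = J) :
    ∃ Adg : ↥𝔲₀ ≃ₜ+ ↥𝔲₀, (∀ X : ↥𝔲₀, ((Adg X : ↥𝔲₀) : Matrix (Fin 3) (Fin 3) K) = g * (X : Matrix (Fin 3) (Fin 3) K) * g⁻¹) ∧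
      (∀ X : ↥𝔲₀, ((Adg.symm X : ↥𝔲₀) : Matrix (Fin 3) (Fin 3) K) = g⁻¹ * (X : Matrix (Fin 3) (Fin 3) K) * g) := by
  subst hJ
  have hdet := isUnit_det_of_unitary σ hg
  have hg' := unitary_inv σ hσ hg
  have hinvinv : g⁻¹⁻¹ = g := Matrix.nonsing_inv_nonsing_inv g hdet
  have hfwd : ∀ X : ↥𝔲₀, g * (X : Matrix (Fin 3) (Fin 3) K) * g⁻¹ ∈ 𝔲₀ := fun X => by
    obtain ⟨hX, htr⟩ := (h𝔲₀ _).1 X.2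
    exact (h𝔲₀ _).2 ⟨unitary_conj_mem σ hσ hg hX, by rw [trace_conj_eq hdet, htr]⟩
  have hbwd : ∀ X : ↥𝔲₀, g⁻¹ * (X : Matrix (Fin 3) (Fin 3) K) * g ∈ 𝔲₀ := fun X => by
    obtain ⟨hX, htr⟩ := (h𝔲₀ _).1 X.2
    have h := unitary_conj_mem σ hσ hg' hX
    rw [hinvinv] at h
    exact (h𝔲₀ _).2 ⟨h, by rw [Matrix.trace_mul_cycle, Matrix.mul_nonsing_inv g hdet, Matrix.one_mul, htr]⟩
  refine ⟨{ toFun := fun X => ⟨g * (X : Matrix (Fin 3) (Fin 3) K) * g⁻¹, hfwd X⟩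
            invFun := fun X => ⟨g⁻¹ * (X : Matrix (Fin 3) (Fin 3) K) * g, hbwd X⟩
            left_inv := fun X => Subtype.ext (by
              change g⁻¹ * (g * (X : Matrix (Fin 3) (Fin 3) K) * g⁻¹) * g = X
              rw [show g⁻¹ * (g * (X : Matrix (Fin 3) (Fin 3) K) * g⁻¹) * g = (g⁻¹ * g) * (X : Matrix (Fin 3) (Fin 3) K) * (g⁻¹ * g) by
                simp only [Matrix.mul_assoc], Matrix.nonsing_inv_mul g hdet, Matrix.one_mul, Matrix.mul_one])
            right_inv := fun X => Subtype.ext (by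
              change g * (g⁻¹ * (X : Matrix (Fin 3) (Fin 3) K) * g) * g⁻¹ = X
              rw [show g * (g⁻¹ * (X : Matrix (Fin 3) (Fin 3) K) * g) * g⁻¹ = (g * g⁻¹) * (X : Matrix (Fin 3) (Fin 3) K) * (g * g⁻¹) by
                simp only [Matrix.mul_assoc], Matrix.mul_nonsing_inv g hdet, Matrix.one_mul, Matrix.mul_one])
            map_add' := fun X Y => Subtype.ext (by
              change g * ((X : Matrix (Fin 3) (Fin 3) K) + Y) * g⁻¹ = g * (X : Matrix (Fin 3) (Fin 3) K) * g⁻¹ + g * (Y : Matrix (Fin 3) (Fin 3) K) * g⁻¹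
              rw [Matrix.mul_add, Matrix.add_mul])
            continuous_toFun := ((continuous_const.matrix_mul continuous_subtype_val).matrix_mul continuous_const).subtype_mk _
            continuous_invFun := ((continuous_const.matrix_mul continuous_subtype_val).matrix_mul continuous_const).subtype_mk _ },
    fun X => rfl, fun X => rfl⟩

/-- **`Ad(g) : ↥𝔲 ≃ₜ+ ↥𝔲`** (no trace condition), same letters. [cite: Rogawski1990, §1.9 p. 8] -/
theorem exists_adEquiv_lie (𝔲 : AddSubgroup (Matrix (Fin 3) (Fin 3) K)) (h𝔲 : ∀ X, X ∈ 𝔲 ↔ (X.map σ)ᵀ * J + J * X = 0)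
    {g : Matrix (Fin 3) (Fin 3) K} (hg : (g.map σ)ᵀ * J * g = J) :
    ∃ Adg : ↥𝔲 ≃ₜ+ ↥𝔲, (∀ X : ↥𝔲, ((Adg X : ↥𝔲) : Matrix (Fin 3) (Fin 3) K) = g * (X : Matrix (Fin 3) (Fin 3) K) * g⁻¹) ∧
      (∀ X : ↥𝔲, ((Adg.symm X : ↥𝔲) : Matrix (Fin 3) (Fin 3) K) = g⁻¹ * (X : Matrix (Fin 3) (Fin 3) K) * g) := by
  subst hJ
  have hdet := isUnit_det_of_unitary σ hg
  have hg' := unitary_inv σ hσ hg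
  have hinvinv : g⁻¹⁻¹ = g := Matrix.nonsing_inv_nonsing_inv g hdet
  have hfwd : ∀ X : ↥𝔲, g * (X : Matrix (Fin 3) (Fin 3) K) * g⁻¹ ∈ 𝔲 := fun X =>
    (h𝔲 _).2 (unitary_conj_mem σ hσ hg ((h𝔲 _).1 X.2))
  have hbwd : ∀ X : ↥𝔲, g⁻¹ * (X : Matrix (Fin 3) (Fin 3) K) * g ∈ 𝔲 := fun X => by
    have h := unitary_conj_mem σ hσ hg' ((h𝔲 _).1 X.2)
    rw [hinvinv] at h
    exact (h𝔲 _).2 h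
  refine ⟨{ toFun := fun X => ⟨g * (X : Matrix (Fin 3) (Fin 3) K) * g⁻¹, hfwd X⟩
            invFun := fun X => ⟨g⁻¹ * (X : Matrix (Fin 3) (Fin 3) K) * g, hbwd X⟩
            left_inv := fun X => Subtype.ext (by
              change g⁻¹ * (g * (X : Matrix (Fin 3) (Fin 3) K) * g⁻¹) * g = X
              rw [show g⁻¹ * (g * (X : Matrix (Fin 3) (Fin 3) K) * g⁻¹) * g = (g⁻¹ * g) * (X : Matrix (Fin 3) (Fin 3) K) * (g⁻¹ * g) by
                simp only [Matrix.mul_assoc], Matrix.nonsing_inv_mul g hdet, Matrix.one_mul, Matrix.mul_one])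
            right_inv := fun X => Subtype.ext (by
              change g * (g⁻¹ * (X : Matrix (Fin 3) (Fin 3) K) * g) * g⁻¹ = X
              rw [show g * (g⁻¹ * (X : Matrix (Fin 3) (Fin 3) K) * g) * g⁻¹ = (g * g⁻¹) * (X : Matrix (Fin 3) (Fin 3) K) * (g * g⁻¹) by
                simp only [Matrix.mul_assoc], Matrix.mul_nonsing_inv g hdet, Matrix.one_mul, Matrix.mul_one])
            map_add' := fun X Y => Subtype.ext (by
              change g * ((X : Matrix (Fin 3) (Fin 3) K) + Y) * g⁻¹ = g * (X : Matrix (Fin 3) (Fin 3) K) * g⁻¹ + g * (Y : Matrix (Fin 3) (Fin 3) K) * g⁻¹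
              rw [Matrix.mul_add, Matrix.add_mul])
            continuous_toFun := ((continuous_const.matrix_mul continuous_subtype_val).matrix_mul continuous_const).subtype_mk _
            continuous_invFun := ((continuous_const.matrix_mul continuous_subtype_val).matrix_mul continuous_const).subtype_mk _ },
    fun X => rfl, fun X => rfl⟩

end Ad

/-! ## §3 `Ad(g)`-invariance of the integrand `ηι` and transfer of local `∫⁻`-finiteness -/

section Transfer

variable {K : Type*} [Field K] [ValuativeRel K] [TopologicalSpace K] [IsNonarchimedeanLocalField K]

/-- **The R2 integrand `ηι X = (√√|discr χ_X|_K)⁻¹` is `Ad(g)`-invariant** (it factors through `χ_X`), for `det g` a unit.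
[cite: Rogawski1990, §4.9 p. 54] -/
theorem etaIota_conj_eq {g : Matrix (Fin 3) (Fin 3) K} (hdet : IsUnit g.det) (X : Matrix (Fin 3) (Fin 3) K) :
    ((NNReal.sqrt (NNReal.sqrt (Literature.NumberTheory.GaloisRepresentations.IsNonarchimedeanLocalField.normAbs K
        (Matrix.charpoly (g * X * g⁻¹)).discr)) : ℝ≥0∞))⁻¹ =
      ((NNReal.sqrt (NNReal.sqrt (Literature.NumberTheory.GaloisRepresentations.IsNonarchimedeanLocalField.normAbs K
        (Matrix.charpoly X).discr)) : ℝ≥0∞))⁻¹ := by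
  rw [charpoly_conj_eq hdet]

variable (𝔲₀ : AddSubgroup (Matrix (Fin 3) (Fin 3) K)) [MeasurableSpace ↥𝔲₀] [BorelSpace ↥𝔲₀]
  [LocallyCompactSpace ↥𝔲₀] [SecondCountableTopology ↥𝔲₀]

/-- **Transfer of local `∫⁻`-finiteness along `Ad(g)`**: for ANY additive Haar measure `μ₀` on `↥𝔲₀` (locally compact, second countable), any `Adg : ↥𝔲₀ ≃ₜ+ ↥𝔲₀` and any
`Adg`-invariant `f`, `f` has finite integral near `X₀` iff near `Adg X₀` (★ (G-FUB) `exists_nhds_setLIntegral_lt_top_iff_of_addEquiv` with `W = V = ↥𝔲₀`, the Haar constant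
absorbed there). [cite: Folland1999, §11.1 Thm. 11.9] -/
theorem exists_nhds_setLIntegral_lt_top_iff_ad (μ₀ : Measure ↥𝔲₀) [μ₀.IsAddHaarMeasure] (Adg : ↥𝔲₀ ≃ₜ+ ↥𝔲₀)
    (f : ↥𝔲₀ → ℝ≥0∞) (hf : ∀ X, f (Adg X) = f X) (X₀ : ↥𝔲₀) :
    (∃ U ∈ 𝓝 X₀, ∫⁻ X in U, f X ∂μ₀ < ∞) ↔ (∃ U ∈ 𝓝 (Adg X₀), ∫⁻ X in U, f X ∂μ₀ < ∞) := by
  have h := Literature.MeasureTheory.Group.exists_nhds_setLIntegral_lt_top_iff_of_addEquiv Adg μ₀ μ₀ f X₀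
  simp only [hf] at h
  exact h.symm

/-- **The `ηι` instance**: for a unitary `g` (so `det g` is a unit) and `Adg` acting by `X ↦ g X g⁻¹` on `↥𝔲₀` (§2), `ηι` has finite integral near `X₀` iff near
`Adg X₀` — the WITT MOVE of D5(iii) and the class-function step of GLOBAL-FINAL. [cite: Folland1999, §11.1 Thm. 11.9] [cite: Rogawski1990, §4.9 p. 54] -/
theorem exists_nhds_setLIntegral_etaIota_lt_top_iff_ad (μ₀ : Measure ↥𝔲₀) [μ₀.IsAddHaarMeasure] {g : Matrix (Fin 3) (Fin 3) K} (hdet : IsUnit g.det)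
    (Adg : ↥𝔲₀ ≃ₜ+ ↥𝔲₀) (hAdg : ∀ X : ↥𝔲₀, ((Adg X : ↥𝔲₀) : Matrix (Fin 3) (Fin 3) K) = g * (X : Matrix (Fin 3) (Fin 3) K) * g⁻¹) (X₀ : ↥𝔲₀) :
    (∃ U ∈ 𝓝 X₀, ∫⁻ X in U, ((NNReal.sqrt (NNReal.sqrt (Literature.NumberTheory.GaloisRepresentations.IsNonarchimedeanLocalField.normAbs K
        (Matrix.charpoly (X : Matrix (Fin 3) (Fin 3) K)).discr)) : ℝ≥0∞))⁻¹ ∂μ₀ < ∞) ↔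
    (∃ U ∈ 𝓝 (Adg X₀), ∫⁻ X in U, ((NNReal.sqrt (NNReal.sqrt (Literature.NumberTheory.GaloisRepresentations.IsNonarchimedeanLocalField.normAbs K
        (Matrix.charpoly (X : Matrix (Fin 3) (Fin 3) K)).discr)) : ℝ≥0∞))⁻¹ ∂μ₀ < ∞) :=
  exists_nhds_setLIntegral_lt_top_iff_ad 𝔲₀ μ₀ Adg _ (fun X => by rw [hAdg, etaIota_conj_eq hdet]) X₀

end Transfer

end Summit.HodgeConjecture.HodgeConjecture.Cruxes.H413.F0P3cStCharTSHCDAdTransport
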